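import Literature.AnabelianGeometry.EtaleTheta.GalSectCuspPairPushforward
import Literature.AnabelianGeometry.EtaleTheta.GalSectTorsorTrivialisation
import Literature.AnabelianGeometry.EtaleTheta.GalSectThm110iii
import Literature.AnabelianGeometry.EtaleTheta.MuTwoSettingCLevel
import Literature.AnabelianGeometry.EtaleTheta.Discharge.Sec1Def17Coverings
import Literature.AnabelianGeometry.EtaleTheta.GalSectDotCCuspDecompCriterionKrull
import HarnessLib

/-!
# [EtTh] Thm. 1.10 (iii)'s cusp datum `MuTwoSetting.DotCCusp` FROM A [GalSect] §4 TRIVIALISATION — a constructor carrying every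
# field by theorems except the `(K^×)^∧`-torsor datum, and its instance at the commutator-axis Krull model `inversionModelκ′`

S. Mochizuki, *The étale theta function …* [EtTh], Publ. RIMS **45** (2009), Thm. 1.10 (iii) p. 30 («the `{±1}`-structure … at the unique cusp of
`Ċ^log` … compatible with the canonical integral structure … preserved by `γ`»), Def. 1.7 p. 27 [cite: MochizukiEtTh2009, Thm 1.10 (iii) p.30];
S. Mochizuki, *Galois sections …* [GalSect], §4 p. 33 («the splittings … form a torsor over `H¹(G_K, Ẑ(1)) ≅ (K^×)^∧`»), Def. 4.1 (iii) p. 34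
[cite: MochizukiGalSect2005, §4 p.33].

abc-iut cell, layer L2, seat abc-iut-w5-d029 (gen 5); CLAIM by line 12:5xZ «DotCCusp AT inversionModelκ′ MODULO THE KUMMER TRIVIALISATION»; NV-L2 census
rows `MuTwoSetting.DotCCusp` (27 consumers, 0 producers at 12:37Z).  Class (b) CONSTRUCTION of abc-iut-w5-d062's frozen-then-C7 record `DotCCusp`
(`GalSectThm110iii`, v2 fields: `augC`, `pair`, `D_le`, `I_eq`, `cusp`, `conj`, `D_inf_range`, `isClosed_D`, `inertia_equiv_zHat`, `torsor`,
`canonical`, `canonical_isStructure`, `etaStructure`, `etaStructure_isStructure`); no interface touched, no `Prop` fact, no instance.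

**`MuTwoSetting.DotCCusp.ofTrivialisation`** — inputs over ANY `M : MuTwoSetting p` and ANY `ε_Z`:
(a) a C-level datum `e : M.CLevelData` (for `augC` and the open — hence closed — embedding `inclX`); (b) a cusp `x` of `X` whose decomposition
group lies in `Π^tp_Ẍ` (`hD : M.decomp x ≤ M.GtpXdd` — this seat's splitting criterion `GalSectDotCCuspDecompCriterion` in its strongest form:
a THEOREM at abc-iut-L2-t10's commutator-axis `inversionModelκ′` (`decomp_le_GtpXdd_inversionModelκ'`), FALSE at every `b`-axis model);
(c) a splitting `S₀` of `(D_x, I_x)` (a THEOREM wherever a Galois section into `D_x` exists); and (d) ONE DATUM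
`eK : ((cuspPairOf X x).pushforward inclX).SplittingClass ≃ GalSect.KxHat X` — a trivialisation of the splitting classes by the REAL `(K^×)^∧ =
ProfiniteCompletion (K^×)`, i.e. [GalSect] §4's «torsor over `H¹(G_K, Ẑ(1)) ≅ (K^×)^∧`» = the Kummer identification read at the cusp (the K2
closer's binder (gen); census C7 «future» clause `kummer`).  OUTPUT: `pair := (D_x, I_x)` pushed into `Π^tp_C` along `inclX` (`conj := 1`),
`D_le` from (b) (`D_x ≤ Π^tp_Ẍ ≤ Π^tp_Ẋ ≤ Π^tp_Ċ`), `I_eq` (`augC ∘ inclX = aug`), `isClosed_D` (closed embedding), `inertia_equiv_zHat`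
(transport of `I_x ≃ₜ* Ẑ`), `torsor := TorsorData.ofEquiv eK` (this seat, p426023), `canonical :=` the `O_K^×`-orbit and `etaStructure :=` the
`μ₂(K)`-orbit of the class of `inclX(S₀)` — both `IsStructure` BY CONSTRUCTION.  So: **every v2 field of `DotCCusp` except the torsor is a
theorem/construction; the census row reduces to the single typed datum (d).**

AT `inversionModelκ′` (abc-iut-L2-t10, p445523; one cusp on the commutator axis `c^Ẑ`): `inrSplittingκ'` (the canonical Galois factor IS a
splitting of `(D_x, I_x) = (c^Ẑ ⋊ G_{ℚ_p}, c^Ẑ)`), `dotCCuspκ'OfTrivialisation eK εZ : DotCCusp εZ`, and the census form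
**`nonempty_dotCCusp_inversionModelκ'_of_trivialisation : Nonempty (SplittingClass ≃ KxHat) → ∀ εZ, Nonempty (DotCCusp εZ)`**.
HONEST SCOPE: no trivialisation `eK` is constructed here (that is the Kummer identification — L4 Kummer theory / LCFT for `(K^×)^∧`, not model
plumbing); at the `b`-axis models no `eK` can help (p443644 / p445383).  Semi-synthetic model; consistency evidence for the typed interfaces only;
nothing of [EtTh]/[GalSect] asserted; no side taken on [IUTchIII] Cor. 3.12; typed ≠ proved.
-/

noncomputable section

namespace Literature.AnabelianGeometry.EtaleTheta

open Literature.AnabelianGeometry.SemiGraphs GalSect _root_.Topology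
open scoped Pointwise

namespace MuTwoSetting

variable {p : ℕ} [Fact p.Prime] (M : MuTwoSetting p)

/-- `inclX : Π^tp_X ↪ Π^tp_C` is a CLOSED embedding (an open embedding — `CLevelData.isOpenEmbedding_inclX` — with open, hence closed, image
subgroup). [cite: MochizukiEtTh2009, Def 1.7 p.27] -/
theorem isClosedEmbedding_inclX (e : M.CLevelData) : IsClosedEmbedding M.inclX := by
  refine ⟨e.isOpenEmbedding_inclX.isEmbedding, ?_⟩
  have h : IsClosed ((M.inclX.range : Subgroup M.GtpC) : Set M.GtpC) := Subgroup.isClosed_of_isOpen _ M.isOpen_range_inclX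
  rwa [MonoidHom.coe_range] at h

/-- `inclX(I_x) = inclX(D_x) ∩ Ker(augC)` for a C-level augmentation extending `aug`. [cite: MochizukiEtTh2009, §2 p.36] -/
theorem map_inclX_inertia_eq (e : M.CLevelData) (x : M.Pt) :
    (M.inertia x).map M.inclX = (M.decomp x).map M.inclX ⊓ e.augC.toMonoidHom.ker := by
  ext y
  constructor
  · rintro ⟨d, hd, rfl⟩
    refine ⟨⟨d, hd.1, rfl⟩, ?_⟩
    have hd2 : M.aug d = 1 := hd.2
    show e.augC.toMonoidHom (M.inclX d) = 1
    change e.augC (M.inclX d) = 1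
    rw [e.augC_inclX, hd2]
  · rintro ⟨⟨d, hd, rfl⟩, hk⟩
    have hk' : e.augC (M.inclX d) = 1 := hk
    rw [e.augC_inclX] at hk'
    exact ⟨d, ⟨hd, hk'⟩, rfl⟩

namespace DotCCusp

variable {M} (e : M.CLevelData) (εZ : M.GtpC) {x : M.Pt} (hx : M.IsCusp x) (hD : M.decomp x ≤ M.GtpXdd)
  {S₀ : Subgroup M.PiTemp} (hS₀ : S₀ ∈ (cuspPairOf M.toTemperedCurve x).splittings)
  (eK : ((cuspPairOf M.toTemperedCurve x).pushforward M.inclX).SplittingClass ≃ KxHat M.toTemperedCurve)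

/-- The base class: the class of `inclX(S₀)` in the pushed pair. [cite: MochizukiGalSect2005, §4 p.33] -/
def baseClass : ((cuspPairOf M.toTemperedCurve x).pushforward M.inclX).SplittingClass :=
  CuspPair.SplittingClass.mk _ (S₀.map M.inclX)
    (CuspPair.map_mem_splittings_pushforward _ (M.isClosedEmbedding_inclX e) hS₀)

/-- **`DotCCusp` from a [GalSect] §4 trivialisation** — every field but the torsor datum is carried by theorems (module docstring).
[cite: MochizukiEtTh2009, Thm 1.10 (iii) p.30] -/
def ofTrivialisation : M.DotCCusp εZ where
  augC := e.augC.toMonoidHom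
  augC_inclX := e.augC_inclX
  pair := (cuspPairOf M.toTemperedCurve x).pushforward M.inclX
  D_le := (Subgroup.map_mono hD).trans ((M.map_GtpXdd_le_dotX εZ).trans (M.dotX_le_dotC εZ))
  I_eq := M.map_inclX_inertia_eq e x
  cusp := x
  cusp_isCusp := hx
  conj := 1
  D_inf_range := CuspPair.pushforward_D_inf_range _ _
  isClosed_D := by
    change IsClosed ((((M.decomp x).map M.inclX : Subgroup M.GtpC)) : Set M.GtpC)
    rw [Subgroup.coe_map]
    exact (M.isClosedEmbedding_inclX e).isClosedMap _ (M.isClosed_decomp x)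
  inertia_equiv_zHat :=
    ⟨CuspPair.inertiaEquivPushforward _ M.continuous_inclX (M.isClosedEmbedding_inclX e).isEmbedding
      (M.inertia_equiv_zHat x hx).some⟩
  torsor := CuspPair.TorsorData.ofEquiv eK
  canonical := {c | ∃ b ∈ unitsHat M.toTemperedCurve, c = (CuspPair.TorsorData.ofEquiv eK).act b (baseClass e hS₀)}
  canonical_isStructure :=
    ⟨baseClass e hS₀, ⟨1, Subgroup.one_mem _, ((CuspPair.TorsorData.ofEquiv eK).act_one _).symm⟩, rfl⟩
  etaStructure := {c | ∃ b ∈ (rootsOfUnityK M.toTemperedCurve 2).map (toKxHat M.toTemperedCurve),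
    c = (CuspPair.TorsorData.ofEquiv eK).act b (baseClass e hS₀)}
  etaStructure_isStructure :=
    ⟨baseClass e hS₀, ⟨1, Subgroup.one_mem _, ((CuspPair.TorsorData.ofEquiv eK).act_one _).symm⟩, rfl⟩

/-- The cusp pair of the constructed datum is `(D_x, I_x)` pushed into `Π^tp_C`. [cite: MochizukiEtTh2009, Thm 1.10 (iii) p.30] -/
@[simp] theorem ofTrivialisation_pair :
    (ofTrivialisation e εZ hx hD hS₀ eK).pair = (cuspPairOf M.toTemperedCurve x).pushforward M.inclX := rfl

/-- Its torsor is the trivialised one. [cite: MochizukiGalSect2005, §4 p.33] -/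
@[simp] theorem ofTrivialisation_torsor :
    (ofTrivialisation e εZ hx hD hS₀ eK).torsor = CuspPair.TorsorData.ofEquiv eK := rfl

include e hx hD hS₀ in
/-- **Census form**: a trivialisation of the pushed splitting classes by `(K^×)^∧` yields a `DotCCusp` (given (a)–(c)).
[cite: MochizukiEtTh2009, Thm 1.10 (iii) p.30] -/
theorem nonempty_of_trivialisation
    (h : Nonempty (((cuspPairOf M.toTemperedCurve x).pushforward M.inclX).SplittingClass ≃ KxHat M.toTemperedCurve)) :
    Nonempty (M.DotCCusp εZ) :=
  ⟨ofTrivialisation e εZ hx hD hS₀ h.some⟩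

end DotCCusp

end MuTwoSetting

/-! ### The commutator-axis Krull model: every input but the trivialisation is a theorem -/

namespace SettingModel

open MuTwoSetting

variable (p : ℕ) [Fact p.Prime]

/-- `Π^tp_X` of the Krull model is Hausdorff. [cite: MochizukiEtTh2009, §1 p.12] -/
theorem t2Space_PiTpκ : T2Space (PiTpκ p) := Semidirect.t2Space_of (isInducing_leftRightκ p)

/-- **The canonical Galois factor `G_{ℚ_p} ↪ c^Ẑ ⋊ G_{ℚ_p}` IS A SPLITTING of the commutator-axis cusp of `curveκ′`** (`S₀ = left⁻¹{1}` closed,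
`S₀ ≤ D_x`, `S₀ ∩ I_x = 1`, `S₀ · I_x = D_x`). [cite: MochizukiGalSect2005, §4 p.33] -/
theorem inrSplittingκ' :
    (SemidirectProduct.inr : GQp p →* PiTpκ p).range ∈ (cuspPairOf (curveκ' p) ()).splittings := by
  haveI := t2Space_PiTpκ p
  have hrange : ((SemidirectProduct.inr : GQp p →* PiTpκ p).range : Set (PiTpκ p)) =
      (fun g : PiTpκ p => g.left) ⁻¹' {1} := by
    ext g
    constructor
    · rintro ⟨σ, rfl⟩; exact SemidirectProduct.left_inr σ
    · intro hg
      exact ⟨g.right, SemidirectProduct.ext (by simpa using hg.symm) (by simp)⟩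
  have hinr : ∀ σ : GQp p, (SemidirectProduct.inr σ : PiTpκ p) ∈ cuspDecompκ p := fun σ => by
    rw [mem_cuspDecompκ_iff, SemidirectProduct.left_inr]
    exact Subgroup.one_mem _
  refine ⟨?_, ?_, ?_, ?_⟩
  · rw [hrange]
    exact isClosed_singleton.preimage (Semidirect.continuous_left (isInducing_leftRightκ p))
  · rintro _ ⟨σ, rfl⟩
    exact hinr σ
  · rw [eq_bot_iff]
    rintro g ⟨⟨σ, rfl⟩, hI⟩
    have hI' : (SemidirectProduct.inr σ : PiTpκ p) ∈ (curveκ' p).inertia () := hI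
    rw [inertia_modelκ'_eq] at hI'
    obtain ⟨q, -, hq⟩ := hI'
    have : σ = 1 := by
      have h := congrArg SemidirectProduct.right hq
      simpa using h.symm
    rw [Subgroup.mem_bot, this, map_one]
  · apply le_antisymm
    · exact sup_le (by rintro _ ⟨σ, rfl⟩; exact hinr σ) inf_le_left
    · intro g hg
      have hdec : (SemidirectProduct.inl g.left : PiTpκ p) * SemidirectProduct.inr g.right = g :=
        SemidirectProduct.inl_left_mul_inr_right g
      rw [← hdec]
      refine Subgroup.mul_mem _ (Subgroup.mem_sup_right ?_) (Subgroup.mem_sup_left ⟨g.right, rfl⟩)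
      change (SemidirectProduct.inl g.left : PiTpκ p) ∈ (curveκ' p).inertia ()
      rw [inertia_modelκ'_eq]
      exact ⟨g.left, hg, rfl⟩

/-- **`DotCCusp` at the commutator-axis Krull record from a trivialisation** (every other input a theorem: C-level datum `cLevelDataInvκ'`,
criterion `decomp_le_GtpXdd_inversionModelκ'`, splitting `inrSplittingκ'`). [cite: MochizukiEtTh2009, Thm 1.10 (iii) p.30] -/
def dotCCuspκ'OfTrivialisation (εZ : (MuTwoSetting.inversionModelκ' p).GtpC)
    (eK : ((cuspPairOf (curveκ' p) ()).pushforward (inclInvκ p)).SplittingClass ≃ KxHat (curveκ' p)) :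
    (MuTwoSetting.inversionModelκ' p).DotCCusp εZ :=
  DotCCusp.ofTrivialisation (M := MuTwoSetting.inversionModelκ' p) (cLevelDataInvκ' p) εZ (x := ()) trivial
    (decomp_le_GtpXdd_inversionModelκ' p ()) (inrSplittingκ' p) eK

/-- **Census form (row `MuTwoSetting.DotCCusp`)**: at `inversionModelκ′` the row reduces to ONE typed datum — a trivialisation of the pushed
splitting classes of the cusp by the real `(K^×)^∧` (the [GalSect] §4 Kummer identification at the cusp): given it, `DotCCusp εZ` is inhabited
for EVERY `ε_Z`. [cite: MochizukiEtTh2009, Thm 1.10 (iii) p.30] -/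
theorem nonempty_dotCCusp_inversionModelκ'_of_trivialisation
    (h : Nonempty (((cuspPairOf (curveκ' p) ()).pushforward (inclInvκ p)).SplittingClass ≃ KxHat (curveκ' p)))
    (εZ : (MuTwoSetting.inversionModelκ' p).GtpC) : Nonempty ((MuTwoSetting.inversionModelκ' p).DotCCusp εZ) :=
  ⟨dotCCuspκ'OfTrivialisation p εZ h.some⟩

end SettingModel

end Literature.AnabelianGeometry.EtaleTheta

end
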